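import Literature.NumberTheory.Transcendental.KZFibredRelations
import Literature.NumberTheory.Transcendental.KZProductIdeal
import Literature.NumberTheory.Transcendental.SemialgebraicMapsProofs

/-!
# `LogKernelConjecture` (stmt-KontsevichZagierPeriods-2837) — line `spectator-localisation`,
stub `stub_reweighting` (E1, reweighting the spectator coordinate)

Given a bounded weight `w : ℝ → ℝ` with `t ↦ w (t 0)` `ℚ`-semialgebraic on `ℝ¹`, every integral
representation `r : KZ.IntegralRep k` with `0 < k` has a **reweighted twin**: same domain, integrand
`x ↦ w (x 0) * r.integrand x` (again `ℚ`-semialgebraic — the weight is the composite of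
`t ↦ w (t 0)` with the polynomial projection `x ↦ (x 0)` — and absolutely integrable, as a bounded
measurable function times an integrable one). The additive extension `φ : FormalRep →+ FormalRep` of
`[r] ↦ [twin of r]` (constants go to `0`) sends each of the four kinds of fibred generators
(`KZ.fibredGenerators`: domain and integrand additivity, fibred changes of variables `Φ x 0 = x 0`,
Newton–Leibniz along the last coordinate over a base of dimension `≥ 1`) to a generator of the same
kind, because every fibred move leaves the spectator coordinate `x 0`, hence the weight, untouched;
so `φ` preserves `KZ.fibredRelations` (`AddSubgroup.closure_le`), exactly as in
`KZ.slabMap_mem_fibredRelations` and `KZ.scale_mem_relations` (reweighting by a constant).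
[folklore]
-/

noncomputable section

open MeasureTheory Set
open Literature.NumberTheory.Transcendental

namespace Summit.KontsevichZagierPeriods.LiouvilleUnfolding.SpectatorLocalisation

/-! ## The weight in one coordinate -/

/-- A weight read in one coordinate, `x ↦ w (x i)`, with `t ↦ w (t 0)` `ℚ`-semialgebraic on `ℝ¹`, is
a `ℚ`-semialgebraic function on every `ℚ`-semialgebraic `s ⊆ ℝᵏ`: it is the composite of
`t ↦ w (t 0)` with the polynomial (coordinate) map `x ↦ (x i) ∈ ℝ¹`
(`IsSemialgebraicFunOn.comp_isSemialgebraicMapOn_holds`, `isSemialgebraicMapOn_aeval`).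
[folklore] -/
theorem stub_reweighting_weight_isSemialgebraicFunOn {w : ℝ → ℝ}
    (hw : IsSemialgebraicFunOn ℚ (Set.univ : Set (Fin 1 → ℝ)) (fun t => w (t 0)))
    {k : ℕ} (i : Fin k) {s : Set (Fin k → ℝ)}
    (hs : Literature.ModelTheory.ExponentialFields.IsSemialgebraic ℚ s) :
    IsSemialgebraicFunOn ℚ s (fun x => w (x i)) := by
  have hP : IsSemialgebraicMapOn ℚ s (fun (x : Fin k → ℝ) (_ : Fin 1) => x i) := by
    simpa only [MvPolynomial.aeval_X] using
      isSemialgebraicMapOn_aeval (k := ℚ) hs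
        (fun _ : Fin 1 => (MvPolynomial.X i : MvPolynomial (Fin k) ℚ))
  exact IsSemialgebraicFunOn.comp_isSemialgebraicMapOn_holds hw hP (mapsTo_univ _ _)

/-- A weight `w` with `t ↦ w (t 0)` `ℚ`-semialgebraic on `ℝ¹` is Borel measurable: semialgebraic
functions are measurable on their domain (`IsSemialgebraicFunOn.measurable_holds`), and
`w = (t ↦ w (t 0)) ∘ (s ↦ (s))`. [folklore] -/
theorem stub_reweighting_weight_measurable {w : ℝ → ℝ}
    (hw : IsSemialgebraicFunOn ℚ (Set.univ : Set (Fin 1 → ℝ)) (fun t => w (t 0))) :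
    Measurable w := by
  have h1 : Measurable ((Set.univ : Set (Fin 1 → ℝ)).restrict fun t => w (t 0)) :=
    IsSemialgebraicFunOn.measurable_holds hw
  have h2 : Measurable fun t : Fin 1 → ℝ => w (t 0) :=
    h1.comp (measurable_id.subtype_mk (p := fun t : Fin 1 → ℝ => t ∈ (Set.univ : Set (Fin 1 → ℝ)))
      (h := fun t => mem_univ t))
  exact h2.comp (measurable_pi_lambda (fun (s : ℝ) (_ : Fin 1) => s) fun _ => measurable_id)

/-- **Reweighted twins.** For a bounded weight `w` with `t ↦ w (t 0)` `ℚ`-semialgebraic on `ℝ¹`,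
every representation `r : KZ.IntegralRep k`, `0 < k`, has a twin with the same domain and integrand
`x ↦ w (x 0) * r.integrand x`: semialgebraic by `IsSemialgebraicFunOn.mul_holds`, integrable as a
bounded measurable function times an integrable one (`MeasureTheory.Integrable.bdd_mul`).
[folklore] -/
theorem stub_reweighting_exists_twin {w : ℝ → ℝ} {M : ℝ}
    (hw : IsSemialgebraicFunOn ℚ (Set.univ : Set (Fin 1 → ℝ)) (fun t => w (t 0)))
    (hM : ∀ x : ℝ, |w x| ≤ M) (k : ℕ) (hk : 0 < k) (r : KZ.IntegralRep k) :
    ∃ r' : KZ.IntegralRep k, r'.domain = r.domain ∧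
      r'.integrand = fun x => w (x ⟨0, hk⟩) * r.integrand x := by
  refine ⟨⟨r.domain, fun x => w (x ⟨0, hk⟩) * r.integrand x, r.isSemialgebraic_domain, ?_, ?_⟩,
    rfl, rfl⟩
  · exact IsSemialgebraicFunOn.mul_holds
      (stub_reweighting_weight_isSemialgebraicFunOn hw ⟨0, hk⟩ r.isSemialgebraic_domain)
      r.isSemialgebraicFunOn_integrand
  · have hm : Measurable fun x : Fin k → ℝ => w (x ⟨0, hk⟩) :=
      (stub_reweighting_weight_measurable hw).comp (measurable_pi_apply _)
    exact Integrable.bdd_mul r.integrableOn hm.aestronglyMeasurable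
      (Filter.Eventually.of_forall fun x => (Real.norm_eq_abs _).le.trans (hM _))

/-! ## Reweighting the fibred generators -/

/-- Reweighting a domain-additivity instance gives a domain-additivity instance (same domains, the
three integrands multiplied by the same weight). [cite: KontsevichZagier2001, §1.2] -/
theorem stub_reweighting_domainAddRel {w : ℝ → ℝ}
    (R : ∀ k : ℕ, 0 < k → KZ.IntegralRep k → KZ.IntegralRep k)
    (hRd : ∀ (k : ℕ) (hk : 0 < k) (r : KZ.IntegralRep k), (R k hk r).domain = r.domain)
    (hRi : ∀ (k : ℕ) (hk : 0 < k) (r : KZ.IntegralRep k),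
      (R k hk r).integrand = fun x => w (x ⟨0, hk⟩) * r.integrand x)
    {k : ℕ} (hk : 0 < k) {r r₁ r₂ : KZ.IntegralRep k}
    (hdom : r.domain = r₁.domain ∪ r₂.domain) (hnull : volume (r₁.domain ∩ r₂.domain) = 0)
    (h₁ : EqOn r.integrand r₁.integrand r₁.domain)
    (h₂ : EqOn r.integrand r₂.integrand r₂.domain) :
    KZ.of (R k hk r) - KZ.of (R k hk r₁) - KZ.of (R k hk r₂) ∈ KZ.domainAddRel := by
  refine ⟨k, R k hk r, R k hk r₁, R k hk r₂, ?_, ?_, fun x hx => ?_, fun x hx => ?_, rfl⟩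
  · rw [hRd, hRd, hRd]
    exact hdom
  · rw [hRd, hRd]
    exact hnull
  · rw [hRd] at hx
    simp only [hRi, h₁ hx]
  · rw [hRd] at hx
    simp only [hRi, h₂ hx]

/-- Reweighting an integrand-additivity instance gives an integrand-additivity instance
(`w f = w f₁ + w f₂` on the common domain). [cite: KontsevichZagier2001, §1.2] -/
theorem stub_reweighting_integrandAddRel {w : ℝ → ℝ}
    (R : ∀ k : ℕ, 0 < k → KZ.IntegralRep k → KZ.IntegralRep k)
    (hRd : ∀ (k : ℕ) (hk : 0 < k) (r : KZ.IntegralRep k), (R k hk r).domain = r.domain)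
    (hRi : ∀ (k : ℕ) (hk : 0 < k) (r : KZ.IntegralRep k),
      (R k hk r).integrand = fun x => w (x ⟨0, hk⟩) * r.integrand x)
    {k : ℕ} (hk : 0 < k) {r r₁ r₂ : KZ.IntegralRep k}
    (h₁ : r₁.domain = r.domain) (h₂ : r₂.domain = r.domain)
    (hadd : EqOn r.integrand (r₁.integrand + r₂.integrand) r.domain) :
    KZ.of (R k hk r) - KZ.of (R k hk r₁) - KZ.of (R k hk r₂) ∈ KZ.integrandAddRel := by
  refine ⟨k, R k hk r, R k hk r₁, R k hk r₂, ?_, ?_, fun x hx => ?_, rfl⟩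
  · rw [hRd, hRd]
    exact h₁
  · rw [hRd, hRd]
    exact h₂
  · rw [hRd] at hx
    simp only [hRi, Pi.add_apply, hadd hx, mul_add]

/-- Reweighting a fibred change of variables gives a fibred change of variables with the same
substitution `Φ`: since `Φ x 0 = x 0`, the weight `w (x 0)` is the same before and after the
substitution, so `w f = (w f') ∘ Φ · |det Φ'|`. [cite: KontsevichZagier2001, §1.2] -/
theorem stub_reweighting_fibredChangeOfVariablesRel {w : ℝ → ℝ}
    (R : ∀ k : ℕ, 0 < k → KZ.IntegralRep k → KZ.IntegralRep k)
    (hRd : ∀ (k : ℕ) (hk : 0 < k) (r : KZ.IntegralRep k), (R k hk r).domain = r.domain)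
    (hRi : ∀ (k : ℕ) (hk : 0 < k) (r : KZ.IntegralRep k),
      (R k hk r).integrand = fun x => w (x ⟨0, hk⟩) * r.integrand x)
    {n : ℕ} {r r' : KZ.IntegralRep (n + 1)} {Φ : (Fin (n + 1) → ℝ) → (Fin (n + 1) → ℝ)}
    {Φ' : (Fin (n + 1) → ℝ) → (Fin (n + 1) → ℝ) →L[ℝ] (Fin (n + 1) → ℝ)}
    (hΦ : IsSemialgebraicMapOn ℚ r.domain Φ)
    (hΦ' : ∀ x ∈ r.domain, HasFDerivWithinAt Φ (Φ' x) r.domain x) (hinj : InjOn Φ r.domain)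
    (hdom : r'.domain = Φ '' r.domain)
    (hf : ∀ x ∈ r.domain, r.integrand x = r'.integrand (Φ x) * |(Φ' x).det|)
    (h0 : ∀ x ∈ r.domain, Φ x 0 = x 0) :
    KZ.of (R (n + 1) (Nat.succ_pos n) r) - KZ.of (R (n + 1) (Nat.succ_pos n) r') ∈
      KZ.fibredChangeOfVariablesRel := by
  have hd : (R (n + 1) (Nat.succ_pos n) r).domain = r.domain := hRd _ _ _
  have hd' : (R (n + 1) (Nat.succ_pos n) r').domain = r'.domain := hRd _ _ _
  have hi : (R (n + 1) (Nat.succ_pos n) r).integrand = fun x => w (x 0) * r.integrand x :=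
    hRi _ _ _
  have hi' : (R (n + 1) (Nat.succ_pos n) r').integrand = fun x => w (x 0) * r'.integrand x :=
    hRi _ _ _
  refine KZ.of_sub_of_mem_fibredChangeOfVariablesRel (Φ := Φ) (Φ' := Φ') ?_ ?_ ?_ ?_ ?_ ?_
  · rw [hd]
    exact hΦ
  · rw [hd]
    exact hΦ'
  · rw [hd]
    exact hinj
  · rw [hd, hd']
    exact hdom
  · intro x hx
    rw [hd] at hx
    simp only [hi, hi', h0 x hx, hf x hx, mul_assoc]
  · intro x hx
    rw [hd] at hx
    exact h0 x hx

/-- Reweighting a Newton–Leibniz move over a base of dimension `≥ 1` gives a Newton–Leibniz move: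
the spectator coordinate `0` is a base coordinate, so along each fibre the weight `w (x 0)` is a
constant; the new primitive is `z ↦ w (z 0) * F z` (semialgebraic on the band, continuous on the
closed fibres, with derivative `w (x 0) * f` on the open fibres), and the new base integrand is
`w (x 0) * (F (x, β x) − F (x, α x))`. [cite: KontsevichZagier2001, §1.2] -/
theorem stub_reweighting_newtonLeibnizRel {w : ℝ → ℝ}
    (hw : IsSemialgebraicFunOn ℚ (Set.univ : Set (Fin 1 → ℝ)) (fun t => w (t 0)))
    (R : ∀ k : ℕ, 0 < k → KZ.IntegralRep k → KZ.IntegralRep k)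
    (hRd : ∀ (k : ℕ) (hk : 0 < k) (r : KZ.IntegralRep k), (R k hk r).domain = r.domain)
    (hRi : ∀ (k : ℕ) (hk : 0 < k) (r : KZ.IntegralRep k),
      (R k hk r).integrand = fun x => w (x ⟨0, hk⟩) * r.integrand x)
    {n : ℕ} {r : KZ.IntegralRep (n + 1 + 1)} {r' : KZ.IntegralRep (n + 1)}
    {α β : (Fin (n + 1) → ℝ) → ℝ} {F : (Fin (n + 1 + 1) → ℝ) → ℝ}
    (hF : IsSemialgebraicFunOn ℚ r.domain F)
    (hα : IsSemialgebraicFunOn ℚ r'.domain α) (hβ : IsSemialgebraicFunOn ℚ r'.domain β)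
    (hle : ∀ x ∈ r'.domain, α x ≤ β x)
    (hband : r.domain = {z | (Fin.init z : Fin (n + 1) → ℝ) ∈ r'.domain ∧
      α (Fin.init z) ≤ z (Fin.last (n + 1)) ∧ z (Fin.last (n + 1)) ≤ β (Fin.init z)})
    (hcont : ∀ x ∈ r'.domain, ContinuousOn (fun t : ℝ => F (Fin.snoc x t)) (Icc (α x) (β x)))
    (hderiv : ∀ x ∈ r'.domain, ∀ t ∈ Ioo (α x) (β x),
      HasDerivAt (fun s : ℝ => F (Fin.snoc x s)) (r.integrand (Fin.snoc x t)) t)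
    (hr' : ∀ x ∈ r'.domain, r'.integrand x = F (Fin.snoc x (β x)) - F (Fin.snoc x (α x))) :
    KZ.of (R (n + 1 + 1) (Nat.succ_pos (n + 1)) r) - KZ.of (R (n + 1) (Nat.succ_pos n) r') ∈
      KZ.newtonLeibnizRel := by
  -- appending a last coordinate does not change the coordinate `0`
  -- (`(0 : Fin (n + 2)) = Fin.castSucc 0` definitionally, then `Fin.snoc_castSucc`)
  have hsnoc : ∀ (x : Fin (n + 1) → ℝ) (t : ℝ), (Fin.snoc x t : Fin (n + 1 + 1) → ℝ) 0 = x 0 := by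
    intro x t
    have h : (0 : Fin (n + 1 + 1)) = Fin.castSucc (0 : Fin (n + 1)) := rfl
    rw [h]
    exact Fin.snoc_castSucc (α := fun _ => ℝ) (p := x) (x := t) (i := 0)
  have hd : (R (n + 1 + 1) (Nat.succ_pos (n + 1)) r).domain = r.domain := hRd _ _ _
  have hd' : (R (n + 1) (Nat.succ_pos n) r').domain = r'.domain := hRd _ _ _
  have hi : (R (n + 1 + 1) (Nat.succ_pos (n + 1)) r).integrand =
      fun z => w (z 0) * r.integrand z :=
    hRi _ _ _
  have hi' : (R (n + 1) (Nat.succ_pos n) r').integrand = fun x => w (x 0) * r'.integrand x :=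
    hRi _ _ _
  refine ⟨n + 1, R (n + 1 + 1) (Nat.succ_pos (n + 1)) r, R (n + 1) (Nat.succ_pos n) r', α, β,
    fun z => w (z 0) * F z, ?_, ?_, ?_, ?_, ?_, ?_, ?_, ?_, rfl⟩
  · rw [hd]
    exact IsSemialgebraicFunOn.mul_holds
      (stub_reweighting_weight_isSemialgebraicFunOn hw 0 r.isSemialgebraic_domain) hF
  · rw [hd']
    exact hα
  · rw [hd']
    exact hβ
  · rw [hd']
    exact hle
  · rw [hd, hd']
    exact hband
  · intro x hx
    rw [hd'] at hx
    simp only [hsnoc]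
    exact continuousOn_const.mul (hcont x hx)
  · intro x hx t ht
    rw [hd'] at hx
    simp only [hi, hsnoc]
    exact (hderiv x hx t ht).const_mul (w (x 0))
  · intro x hx
    rw [hd'] at hx
    simp only [hi', hr' x hx, mul_sub, hsnoc]

/-- **Reweighting preserves the fibred relations.** An additive endomorphism `φ` of `FormalRep`
which sends every generator `[r]` of positive dimension to its reweighted twin `[R r]` (same domain,
integrand `w (x 0) * r.integrand x`) and kills constants maps `KZ.fibredRelations` into itself:
generator by generator (`stub_reweighting_domainAddRel`, `_integrandAddRel`,
`_fibredChangeOfVariablesRel`, `_newtonLeibnizRel`; constants only occur in the additivity moves and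
go to `0`), then `AddSubgroup.closure_le`. [cite: KontsevichZagier2001, §1.2] -/
theorem stub_reweighting_map_mem_fibredRelations {w : ℝ → ℝ}
    (hw : IsSemialgebraicFunOn ℚ (Set.univ : Set (Fin 1 → ℝ)) (fun t => w (t 0)))
    (R : ∀ k : ℕ, 0 < k → KZ.IntegralRep k → KZ.IntegralRep k)
    (hRd : ∀ (k : ℕ) (hk : 0 < k) (r : KZ.IntegralRep k), (R k hk r).domain = r.domain)
    (hRi : ∀ (k : ℕ) (hk : 0 < k) (r : KZ.IntegralRep k),
      (R k hk r).integrand = fun x => w (x ⟨0, hk⟩) * r.integrand x)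
    (φ : KZ.FormalRep →+ KZ.FormalRep)
    (hpos : ∀ (k : ℕ) (hk : 0 < k) (r : KZ.IntegralRep k), φ (KZ.of r) = KZ.of (R k hk r))
    (hzero : ∀ r : KZ.IntegralRep 0, φ (KZ.of r) = 0)
    {c : KZ.FormalRep} (hc : c ∈ KZ.fibredRelations) : φ c ∈ KZ.fibredRelations := by
  refine (AddSubgroup.closure_le (KZ.fibredRelations.comap φ)).mpr ?_ hc
  rintro c (((hc | hc) | hc) | hc)
  · obtain ⟨k, r, r₁, r₂, hdom, hnull, h₁, h₂, rfl⟩ := hc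
    rw [AddSubgroup.coe_comap, mem_preimage, map_sub, map_sub]
    rcases Nat.eq_zero_or_pos k with rfl | hk
    · rw [hzero, hzero, hzero, sub_zero, sub_zero]
      exact KZ.fibredRelations.zero_mem
    · rw [hpos k hk, hpos k hk, hpos k hk]
      exact KZ.mem_fibredRelations_of_mem_domainAddRel
        (stub_reweighting_domainAddRel R hRd hRi hk hdom hnull h₁ h₂)
  · obtain ⟨k, r, r₁, r₂, h₁, h₂, hadd, rfl⟩ := hc
    rw [AddSubgroup.coe_comap, mem_preimage, map_sub, map_sub]
    rcases Nat.eq_zero_or_pos k with rfl | hk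
    · rw [hzero, hzero, hzero, sub_zero, sub_zero]
      exact KZ.fibredRelations.zero_mem
    · rw [hpos k hk, hpos k hk, hpos k hk]
      exact KZ.mem_fibredRelations_of_mem_integrandAddRel
        (stub_reweighting_integrandAddRel R hRd hRi hk h₁ h₂ hadd)
  · obtain ⟨n, r, r', Φ, Φ', hΦ, hΦ', hinj, hdom, hf, h0, rfl⟩ := hc
    rw [AddSubgroup.coe_comap, mem_preimage, map_sub, hpos (n + 1) (Nat.succ_pos n),
      hpos (n + 1) (Nat.succ_pos n)]
    exact KZ.mem_fibredRelations_of_mem_fibredChangeOfVariablesRel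
      (stub_reweighting_fibredChangeOfVariablesRel R hRd hRi hΦ hΦ' hinj hdom hf h0)
  · obtain ⟨n, r, r', α, β, F, hF, hα, hβ, hle, hband, hcont, hderiv, hr', rfl⟩ :=
      KZ.mem_fibredNewtonLeibnizRel_iff.mp hc
    rw [AddSubgroup.coe_comap, mem_preimage, map_sub, hpos (n + 2) (Nat.succ_pos (n + 1)),
      hpos (n + 1) (Nat.succ_pos n)]
    exact KZ.mem_fibredRelations_of_mem_fibredNewtonLeibnizRel
      (KZ.of_sub_of_mem_fibredNewtonLeibnizRel
        (stub_reweighting_newtonLeibnizRel hw R hRd hRi hF hα hβ hle hband hcont hderiv hr'))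

/-! ## The stub -/

/-- **Stub E1 — reweighting the spectator coordinate.** For a bounded weight `w : ℝ → ℝ` with
`t ↦ w (t 0)` `ℚ`-semialgebraic on `ℝ¹` there is an additive endomorphism `φ` of `KZ.FormalRep`
sending every representation `[r]` of positive dimension `k` to a reweighted twin `[r']`
(`r'.domain = r.domain`, `r'.integrand x = w (x 0) * r.integrand x`; constants go to `0`), and `φ`
preserves `KZ.fibredRelations`: `φ` is `FreeAbelianGroup.lift` of `[r] ↦ [twin]`
(`stub_reweighting_exists_twin`), and it maps each fibred generator to a fibred generator of the
same kind (`stub_reweighting_map_mem_fibredRelations`). [cite: KontsevichZagier2001, §1.2] -/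
theorem stub_reweighting : ∀ (w : ℝ → ℝ) (M : ℝ), Literature.NumberTheory.Transcendental.IsSemialgebraicFunOn ℚ (Set.univ : Set (Fin 1 → ℝ)) (fun t => w (t 0)) → (∀ x : ℝ, |w x| ≤ M) → ∃ φ : Literature.NumberTheory.Transcendental.KZ.FormalRep →+ Literature.NumberTheory.Transcendental.KZ.FormalRep, (∀ (k : ℕ) (hk : 0 < k) (r : Literature.NumberTheory.Transcendental.KZ.IntegralRep k), ∃ r' : Literature.NumberTheory.Transcendental.KZ.IntegralRep k, r'.domain = r.domain ∧ (r'.integrand = fun x => w (x ⟨0, hk⟩) * r.integrand x) ∧ φ (Literature.NumberTheory.Transcendental.KZ.of r) = Literature.NumberTheory.Transcendental.KZ.of r') ∧ ∀ c ∈ Literature.NumberTheory.Transcendental.KZ.fibredRelations, φ c ∈ Literature.NumberTheory.Transcendental.KZ.fibredRelations := by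
  intro w M hw hM
  choose R hRd hRi using stub_reweighting_exists_twin hw hM
  refine ⟨FreeAbelianGroup.lift fun x : Σ k, KZ.IntegralRep k =>
      if hk : 0 < x.1 then KZ.of (R x.1 hk x.2) else 0, fun k hk r => ?_, fun c hc => ?_⟩
  · exact ⟨R k hk r, hRd k hk r, hRi k hk r,
      (FreeAbelianGroup.lift_apply_of _ _).trans (dif_pos hk)⟩
  · exact stub_reweighting_map_mem_fibredRelations hw R hRd hRi _
      (fun k hk r => (FreeAbelianGroup.lift_apply_of _ _).trans (dif_pos hk))
      (fun r => (FreeAbelianGroup.lift_apply_of _ _).trans (dif_neg (Nat.lt_irrefl 0))) hc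

end Summit.KontsevichZagierPeriods.LiouvilleUnfolding.SpectatorLocalisation

end
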